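import Summits.ValiantsHypothesis.ValiantsHypothesis.Theorems.BarrierLeverAnchoredDoorHitsLowerPairsStarSpec
import Summits.ValiantsHypothesis.ValiantsHypothesis.Theorems.BarrierLeverAnchoredDoorHitsLowerPairsStubGenericPoint

/-!
# Support item `AnchoredDoorHitsLowerPairs` (stmt-ValiantsHypothesis-22510), line `anchored-peeling`:
# CONJECTURE GH — the doubly-generalized layout matrix of the door is SUPPORT-GENERIC

Helper file (`--supports stmt-ValiantsHypothesis-22510`; cell valiant-natproofs, rung V4, 𝒟-side door (c); registered line
`Cruxes/AnchoredDoorHitsLowerPairs/Lines/anchored_peeling.lean` v12; prover seat val-np-p1 gen 19). Bookkeeping `def`s (`genEntry₂`, `genDet₂`, `Supp₂`), two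
stub texts (`Stmt.stub_supportGeneric` = CONJECTURE GH, OFFERED under D-0145 and NOT asserted; `Stmt.stub_totallyNonsingular` restated VERBATIM from the skeleton,
where it is the registered stub TU1 of val-np-p2 g11), and the kernel transfers GH ⟹ TU1 ⟹ symbolic non-vanishing on lower pairs. Closes NO item.

THE OBJECT (memo HOME/val-np-p1/g19/PEEL-HALL-valnp1-g19.md §3). Label ROWS by pairs `(U | E)` and COLUMNS by pairs `(B | W)` (`U, B` sets of `x`-vertices, `E, W` sets
of `y`-vertices); the entry is the reading `[B ⊆ U][E ⊆ W] · [x^{U∖B} y^{W∖E}] 𝔄_s` (`genEntry₂`; `E = B = ∅` gives the ordinary layout matrix, `B = ∅` the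
generalized rows of the DT-peel files). Up to relabelling `W ↦ Y ∖ W`, `E ↦ Y ∖ E` this is the matrix of MULTIPLICATION BY THE DOOR on the zeon algebra `Z_{X⊔Y}` in
the monomial basis. Its SUPPORT is `Supp₂`: `B ⊆ U`, `E ⊆ W` and `U∖B = ∅ ⟺ W∖E = ∅` (a nonempty `x`-part needs a nonempty `y`-part and conversely).
**CONJECTURE GH (profile 1):** a square sub-pattern with pairwise distinct row labels and column labels is NONSINGULAR as soon as its support admits a perfect
matching — «multiplication by the generic door is a support-generic operator». EVIDENCE (lab/exp_gh*.py, kit j300812/j302319/j302936; exact rank mod 2⁶¹−1):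
0 anomalies in ≈ 20 000 random instances (arbitrary, non-lower, `x`-shifted columns, tiny cores), 13 201 nonsingular-with-matching + 5 399 singular-without in
kit j300812; the `k`-bare-peel Hall statements (k = 2, 3: 47 772 census instances) are sub-cases. It FAILS for the crossed member X (13/1 000; the
anchor-dependent `y`-tails are needed). TU1 (`Stmt.stub_totallyNonsingular`) is the sub-case `E = B = ∅`; U1 the sub-case of lower families.

* `Stmt.stub_supportGeneric` — Conjecture GH.   * `Stmt.stub_totallyNonsingular` — TU1, verbatim from the skeleton (v7).
* `stub_totallyNonsingular_of_supportGeneric` — **GH ⟹ TU1** (plain labels; the matching is the identity, or the transposition pairing the empty row with the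
  empty column).   * `stub_symbolicNonvanishing_of_totallyNonsingular`, `…_of_supportGeneric`, `anchoredHit_of_supportGeneric` — down to the line's stub.
WHY GH MIGHT FAIL: it is much stronger than U1; cheapest falsifier = one square sub-pattern with a perfect matching in its support and two singular random
evaluations (lab/exp_gh2.py, milliseconds). WHY IT IS ATTRACTIVE: support-genericity is closed under Hall-tight splitting (memo §3.4), so GH reduces to
'elementary' supports; and it is a statement about ONE natural operator (m_D on the zeon algebra).

WHAT THIS IS NOT: no claim that GH or TU1 holds; nothing on crux stmt-ValiantsHypothesis-14610 or on `VP` versus `VNP`.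
-/

set_option linter.dupNamespace false

namespace Summit.ValiantsHypothesis.ValiantsHypothesis.Theorems.BarrierLever.AnchoredPeeling

open Finset MvPolynomial
open Summit.ValiantsHypothesis.ValiantsHypothesis.Theorems.BarrierLever.BrickCalculus (pexpo pexpo_def)

noncomputable section

variable {h : ℕ}

/-- The doubly-generalized entry: row label `(U | E)`, column label `(B | W)`, reading `[B ⊆ U][E ⊆ W]·[x^{U∖B} y^{W∖E}] 𝔄_s`. -/
def genEntry₂ (s h : ℕ) (U E B W : Finset (Fin h)) : MvPolynomial (Param h) ℂ :=
  if B ⊆ U ∧ E ⊆ W then coeff (pexpo (U \ B) (W \ E)) (symbolicWitness s h) else 0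

/-- The determinant of a square sub-pattern of the doubly-generalized layout matrix. -/
def genDet₂ (s h r : ℕ) (U E B W : Fin r → Finset (Fin h)) : MvPolynomial (Param h) ℂ :=
  (Matrix.of fun i j => genEntry₂ s h (U i) (E i) (B j) (W j)).det

/-- The support relation of the doubly-generalized matrix: `B ⊆ U`, `E ⊆ W`, and the free parts are both empty or both nonempty. -/
def Supp₂ (U E B W : Finset (Fin h)) : Prop :=
  B ⊆ U ∧ E ⊆ W ∧ (U \ B = ∅ ↔ W \ E = ∅)

/-- **STUB (CONJECTURE GH, profile 1).** Every square sub-pattern of the doubly-generalized layout matrix of the profile-1 door with pairwise distinct row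
labels `(U i | E i)`, pairwise distinct column labels `(B j | W j)` and a perfect matching inside its support is nonsingular. -/
def Stmt.stub_supportGeneric : Prop :=
  ∀ (h r : ℕ) (U E B W : Fin r → Finset (Fin h)),
    (∀ i i', U i = U i' → E i = E i' → i = i') → (∀ j j', B j = B j' → W j = W j' → j = j') →
    (∃ σ : Equiv.Perm (Fin r), ∀ i, Supp₂ (U i) (E i) (B (σ i)) (W (σ i))) →
    genDet₂ 1 h r U E B W ≠ 0

/-- **STUB TU1** (verbatim from the skeleton `Cruxes/…/anchored_peeling.lean`, v7; conjecture of val-np-p2 g11): total nonsingularity of the profile-1 door under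
matched emptiness. -/
def Stmt.stub_totallyNonsingular : Prop :=
  ∀ (h r : ℕ) (u w : Fin r → Finset (Fin h)), Function.Injective u → Function.Injective w →
    ((∃ i, u i = ∅) ↔ (∃ j, w j = ∅)) → symbolicDet 1 h r u w ≠ 0

/-- With empty shifts on both sides the doubly-generalized determinant is the symbolic minor. -/
theorem genDet₂_plain (s h r : ℕ) (u w : Fin r → Finset (Fin h)) :
    genDet₂ s h r u (fun _ => ∅) (fun _ => ∅) w = symbolicDet s h r u w := by
  unfold genDet₂ genEntry₂ symbolicDet
  congr 1
  ext i j
  rw [Matrix.of_apply, Matrix.of_apply, if_pos ⟨Finset.empty_subset _, Finset.empty_subset _⟩, Finset.sdiff_empty, Finset.sdiff_empty,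
    pexpo_def]

/-- Matched emptiness of two injective plain families yields a perfect matching in the support. -/
theorem exists_perm_supp₂_plain {r : ℕ} (u w : Fin r → Finset (Fin h)) (hu : Function.Injective u) (hw : Function.Injective w)
    (hm : (∃ i, u i = ∅) ↔ (∃ j, w j = ∅)) :
    ∃ σ : Equiv.Perm (Fin r), ∀ i, Supp₂ (u i) ∅ ∅ (w (σ i)) := by
  classical
  have key : ∀ (σ : Equiv.Perm (Fin r)), (∀ i, u i = ∅ ↔ w (σ i) = ∅) → ∀ i, Supp₂ (u i) ∅ ∅ (w (σ i)) := by
    intro σ hσ i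
    refine ⟨Finset.empty_subset _, Finset.empty_subset _, ?_⟩
    rw [Finset.sdiff_empty, Finset.sdiff_empty]
    exact hσ i
  by_cases hex : ∃ i, u i = ∅
  · obtain ⟨i₀, hi₀⟩ := hex
    obtain ⟨j₀, hj₀⟩ := hm.mp ⟨i₀, hi₀⟩
    refine ⟨Equiv.swap i₀ j₀, key _ fun i => ?_⟩
    by_cases hi : i = i₀
    · subst hi
      rw [Equiv.swap_apply_left]
      exact ⟨fun _ => hj₀, fun _ => hi₀⟩
    · by_cases hj : i = j₀
      · subst hj
        rw [Equiv.swap_apply_right]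
        constructor
        · intro h1; exact absurd (hu (h1.trans hi₀.symm)) hi
        · intro h2; exact absurd (hw (h2.trans hj₀.symm)) (Ne.symm hi)
      · rw [Equiv.swap_apply_of_ne_of_ne hi hj]
        constructor
        · intro h1; exact absurd (hu (h1.trans hi₀.symm)) hi
        · intro h2; exact absurd (hw (h2.trans hj₀.symm)) hj
  · refine ⟨Equiv.refl _, key _ fun i => ?_⟩
    rw [Equiv.refl_apply]
    constructor
    · intro h1; exact absurd ⟨i, h1⟩ hex
    · intro h2; exact absurd (hm.mpr ⟨i, h2⟩) hex

/-- **GH ⟹ TU1.** -/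
theorem stub_totallyNonsingular_of_supportGeneric (H : Stmt.stub_supportGeneric) : Stmt.stub_totallyNonsingular := by
  intro h r u w hu hw hm
  rw [← genDet₂_plain]
  exact H h r u (fun _ => ∅) (fun _ => ∅) w (fun i i' hii' _ => hu hii') (fun j j' _ hjj' => hw hjj')
    (exists_perm_supp₂_plain u w hu hw hm)

/-- **TU1 ⟹ symbolic non-vanishing on injective lower pairs** (for `r ≥ 1` both sides contain `∅`; profile `1`, `h₀ = 0`). -/
theorem symbolicDet_one_ne_zero_of_totallyNonsingular (H : Stmt.stub_totallyNonsingular) (h r : ℕ) (u w : Fin r → Finset (Fin h))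
    (hu : Function.Injective u) (hw : Function.Injective w) (hlu : IsLowerSet (Set.range u)) (hlw : IsLowerSet (Set.range w)) :
    symbolicDet 1 h r u w ≠ 0 := by
  refine H h r u w hu hw ?_
  rcases Nat.eq_zero_or_pos r with hr | hr
  · subst hr
    exact ⟨fun ⟨i, _⟩ => i.elim0, fun ⟨j, _⟩ => j.elim0⟩
  · have hu0 : (∅ : Finset (Fin h)) ∈ Set.range u := hlu (Finset.empty_subset (u ⟨0, hr⟩)) ⟨⟨0, hr⟩, rfl⟩
    have hw0 : (∅ : Finset (Fin h)) ∈ Set.range w := hlw (Finset.empty_subset (w ⟨0, hr⟩)) ⟨⟨0, hr⟩, rfl⟩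
    obtain ⟨i, hi⟩ := hu0
    obtain ⟨j, hj⟩ := hw0
    exact ⟨fun _ => ⟨j, hj⟩, fun _ => ⟨i, hi⟩⟩

/-- TU1 implies the line's symbolic non-vanishing stub (`s := 1`, `h₀ := 0`). -/
theorem stub_symbolicNonvanishing_of_totallyNonsingular (H : Stmt.stub_totallyNonsingular) : Stmt.stub_symbolicNonvanishing :=
  ⟨1, 0, fun h _ r u w hu hw hlu hlw => symbolicDet_one_ne_zero_of_totallyNonsingular H h r u w hu hw hlu hlw⟩

/-- **Conjecture GH implies the line's symbolic non-vanishing stub.** -/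
theorem stub_symbolicNonvanishing_of_supportGeneric (H : Stmt.stub_supportGeneric) : Stmt.stub_symbolicNonvanishing :=
  stub_symbolicNonvanishing_of_totallyNonsingular (stub_totallyNonsingular_of_supportGeneric H)

/-- Hence an anchored hit on every injective simplicial-complex pair at profile 1 (the landed `stub_genericPoint`). -/
theorem anchoredHit_of_supportGeneric (H : Stmt.stub_supportGeneric) (h r : ℕ) (u w : Fin r → Finset (Fin h))
    (hu : Function.Injective u) (hw : Function.Injective w) (hlu : IsLowerSet (Set.range u)) (hlw : IsLowerSet (Set.range w)) :
    AnchoredHit 1 h r u w :=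
  stub_genericPoint 1 h r u w
    (symbolicDet_one_ne_zero_of_totallyNonsingular (stub_totallyNonsingular_of_supportGeneric H) h r u w hu hw hlu hlw)

end

end Summit.ValiantsHypothesis.ValiantsHypothesis.Theorems.BarrierLever.AnchoredPeeling
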